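import Summits.Ventures.Crystal3D.Theorems.StickyWulffConstantNoReconstructionGainAxisBarlowLocal
import HarnessLib

/-!
# Basal Barlow films at the OTHER `(111)` axes: the atom at exact `{111}` facet normals

HONEST FRAMING. Part of the venture `Summits/Ventures/Crystal3D` (cell `crystal3d-full`), helper
`--supports` the crux `NoReconstructionGain` (stmt-Ventures-19144, route
`route-Ventures-StickyWulffConstant`), line `adhesion`.  `basalBarlowFilm_adhesion` covers every film
inside `B = Λ₀ ∪ (Λ₀ + w) ∪ (Λ₀ − w)` (all Barlow positions of the basal family) at normals within
`54.7°` of the basal axis.  The other three `(111)` axes of `Λ₀` are at `70.5°` — outside that cone —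
but at these EXACT directions the `ν`-height still certifies every `B`-film:

* `axis_negative_directions`, `axis_level_directions` — of the eighteen contact vectors of `B`
  (`basal_unit_vectors`), the ones that are negative along `u + v + t` are `−u, −v, −t`, the twin-hollow
  vector `A = t − u − v + w` and the two lower twin-hollow vectors `−B₁ = −(t − v + w)`,
  `−B₂ = −(t − u + w)`; the level ones are `±(u − v)`, `±(t − u)`, `±(t − v)`;
* `axis_noGainPotential` — per ball: in-plane `2·2 + 2`, up `≤ 2` (`A` excludes `t − u`, `t − v`:
  they sit at distance `√(1/3)`), down `≤ 4` (`−t` excludes `−B₁, −B₂`; `u − t` excludes `−B₂`;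
  `v − t` excludes `−B₁`): `2·#below + #level ≤ 12`;
* `axisBarlowFilm_adhesion` (**the rung**, `R = 1`, `C = 0`; registered by name): for the unit normal
  `ν = (u + v + t)/√6` and every `ρ ≥ 1`, every finite unit packing `X ⊇ P` around the `ν`-slab sample
  whose film lies in `B` and above the cut satisfies `#cross(P, X \ P) ≤ contactDeficiency (X \ P)`.

With the lattice symmetries (`…BasalBarlowFilmOrbit` pattern) this gives: at an EXACT `{111}` facet
normal, every single-family Barlow film of ANY of the four families — in particular Σ3 twin lamellae
on the three inclined `{111}` planes reaching the facet (multiply-twinned particles) — gains nothing.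
Census: pure height had zero violations on all 34 inclined-family films at `ν = (111)` (RUNGS-g8 §4).

WHAT THIS IS NOT: vicinal normals near `(111)` with inclined-family films (there `ν' ≠ ν` is needed,
censused only); the orbit transport (next file); rung F-C1 not moved.
-/

noncomputable section

namespace Summit.Ventures.Crystal3D.Theorems

open Summit.Ventures.Crystal3D Finset
open Literature.MathematicalPhysics.StatisticalMechanics (barlowPos barlowStacking fccStacking
  barlowOffset constHagg haggLabel_const barlowPos_apply_zero barlowPos_apply_one barlowPos_apply_two
  orderedContacts contactDeficiency)
open scoped InnerProductSpace

/-! ### Classification of the contact vectors by their sign along `u + v + t` -/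

/-- The contact vectors of `B` that are NEGATIVE along `u + v + t`. -/
theorem axis_negative_directions {d : EuclideanSpace ℝ (Fin 3)}
    (hd : (∃ c ∈ ([((0 : ℤ), (1 : ℤ), (0 : ℤ)), (0, 0, 1), (1, 0, 0), (0, 1, -1), (-1, 1, 0), (-1, 0, 1)] :
        List (ℤ × ℤ × ℤ)),
        d = barlowPos 1 (Real.sqrt (2 / 3)) constHagg c.1 c.2.1 c.2.2 ∨
        d = -barlowPos 1 (Real.sqrt (2 / 3)) constHagg c.1 c.2.1 c.2.2) ∨
      (∃ c ∈ ([((1 : ℤ), (-1 : ℤ), (-1 : ℤ)), (1, 0, -1), (1, -1, 0)] : List (ℤ × ℤ × ℤ)),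
        d = barlowPos 1 (Real.sqrt (2 / 3)) constHagg c.1 c.2.1 c.2.2 + barlowOffset 1 ∨
        d = -(barlowPos 1 (Real.sqrt (2 / 3)) constHagg c.1 c.2.1 c.2.2 + barlowOffset 1)))
    (hneg : ⟪d, barlowPos 1 (Real.sqrt (2 / 3)) constHagg 1 1 1⟫_ℝ < 0) :
    (d = -barlowPos 1 (Real.sqrt (2 / 3)) constHagg 0 1 0 ∨ d = -barlowPos 1 (Real.sqrt (2 / 3)) constHagg 0 0 1) ∨
    d = barlowPos 1 (Real.sqrt (2 / 3)) constHagg 1 (-1) (-1) + barlowOffset 1 ∨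
    (d = -barlowPos 1 (Real.sqrt (2 / 3)) constHagg 1 0 0 ∨
      d = -(barlowPos 1 (Real.sqrt (2 / 3)) constHagg 1 0 (-1) + barlowOffset 1) ∨
      d = -(barlowPos 1 (Real.sqrt (2 / 3)) constHagg 1 (-1) 0 + barlowOffset 1)) := by
  have hw := inner_axis_barlowOffset
  rcases hd with ⟨c, hc, hdc⟩ | ⟨c, hc, hdc⟩
  · simp only [List.mem_cons, List.mem_nil_iff, or_false] at hc
    rcases hc with rfl | rfl | rfl | rfl | rfl | rfl <;> rcases hdc with rfl | rfl <;>
      simp only [inner_neg_left, inner_axis_barlowPos] at hneg <;> norm_num at hneg <;> simp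
  · simp only [List.mem_cons, List.mem_nil_iff, or_false] at hc
    rcases hc with rfl | rfl | rfl <;> rcases hdc with rfl | rfl <;>
      simp only [inner_neg_left, inner_add_left, inner_axis_barlowPos, hw] at hneg <;>
      norm_num at hneg <;> simp

/-- The contact vectors of `B` that are LEVEL along `u + v + t`. -/
theorem axis_level_directions {d : EuclideanSpace ℝ (Fin 3)}
    (hd : (∃ c ∈ ([((0 : ℤ), (1 : ℤ), (0 : ℤ)), (0, 0, 1), (1, 0, 0), (0, 1, -1), (-1, 1, 0), (-1, 0, 1)] :
        List (ℤ × ℤ × ℤ)),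
        d = barlowPos 1 (Real.sqrt (2 / 3)) constHagg c.1 c.2.1 c.2.2 ∨
        d = -barlowPos 1 (Real.sqrt (2 / 3)) constHagg c.1 c.2.1 c.2.2) ∨
      (∃ c ∈ ([((1 : ℤ), (-1 : ℤ), (-1 : ℤ)), (1, 0, -1), (1, -1, 0)] : List (ℤ × ℤ × ℤ)),
        d = barlowPos 1 (Real.sqrt (2 / 3)) constHagg c.1 c.2.1 c.2.2 + barlowOffset 1 ∨
        d = -(barlowPos 1 (Real.sqrt (2 / 3)) constHagg c.1 c.2.1 c.2.2 + barlowOffset 1)))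
    (hzero : ⟪d, barlowPos 1 (Real.sqrt (2 / 3)) constHagg 1 1 1⟫_ℝ = 0) :
    (d = barlowPos 1 (Real.sqrt (2 / 3)) constHagg 0 1 (-1) ∨ d = -barlowPos 1 (Real.sqrt (2 / 3)) constHagg 0 1 (-1)) ∨
    (d = -barlowPos 1 (Real.sqrt (2 / 3)) constHagg (-1) 1 0 ∨ d = -barlowPos 1 (Real.sqrt (2 / 3)) constHagg (-1) 0 1) ∨
    (d = barlowPos 1 (Real.sqrt (2 / 3)) constHagg (-1) 1 0 ∨ d = barlowPos 1 (Real.sqrt (2 / 3)) constHagg (-1) 0 1) := by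
  have hw := inner_axis_barlowOffset
  rcases hd with ⟨c, hc, hdc⟩ | ⟨c, hc, hdc⟩
  · simp only [List.mem_cons, List.mem_nil_iff, or_false] at hc
    rcases hc with rfl | rfl | rfl | rfl | rfl | rfl <;> rcases hdc with rfl | rfl <;>
      simp only [inner_neg_left, inner_axis_barlowPos] at hzero <;> norm_num at hzero <;> simp
  · simp only [List.mem_cons, List.mem_nil_iff, or_false] at hc
    rcases hc with rfl | rfl | rfl <;> rcases hdc with rfl | rfl <;>
      simp only [inner_neg_left, inner_add_left, inner_axis_barlowPos, hw] at hzero <;>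
      norm_num at hzero

/-! ### The six incompatibilities -/

/-- Squared distances `1/3` between the conflicting slot vectors (coordinates). -/
theorem axis_conflict_norms :
    ‖(barlowPos 1 (Real.sqrt (2 / 3)) constHagg 1 (-1) (-1) + barlowOffset 1) -
        -barlowPos 1 (Real.sqrt (2 / 3)) constHagg (-1) 1 0‖ ^ 2 = 1 / 3 ∧
    ‖(barlowPos 1 (Real.sqrt (2 / 3)) constHagg 1 (-1) (-1) + barlowOffset 1) -
        -barlowPos 1 (Real.sqrt (2 / 3)) constHagg (-1) 0 1‖ ^ 2 = 1 / 3 ∧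
    ‖-barlowPos 1 (Real.sqrt (2 / 3)) constHagg 1 0 0 -
        -(barlowPos 1 (Real.sqrt (2 / 3)) constHagg 1 0 (-1) + barlowOffset 1)‖ ^ 2 = 1 / 3 ∧
    ‖-barlowPos 1 (Real.sqrt (2 / 3)) constHagg 1 0 0 -
        -(barlowPos 1 (Real.sqrt (2 / 3)) constHagg 1 (-1) 0 + barlowOffset 1)‖ ^ 2 = 1 / 3 ∧
    ‖barlowPos 1 (Real.sqrt (2 / 3)) constHagg (-1) 1 0 -
        -(barlowPos 1 (Real.sqrt (2 / 3)) constHagg 1 (-1) 0 + barlowOffset 1)‖ ^ 2 = 1 / 3 ∧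
    ‖barlowPos 1 (Real.sqrt (2 / 3)) constHagg (-1) 0 1 -
        -(barlowPos 1 (Real.sqrt (2 / 3)) constHagg 1 0 (-1) + barlowOffset 1)‖ ^ 2 = 1 / 3 := by
  have h3 : Real.sqrt 3 ^ 2 = 3 := Real.sq_sqrt (by norm_num)
  have hh : Real.sqrt (2 / 3) ^ 2 = 2 / 3 := Real.sq_sqrt (by norm_num)
  refine ⟨?_, ?_, ?_, ?_, ?_, ?_⟩ <;>
  · rw [EuclideanSpace.real_norm_sq_eq, Fin.sum_univ_three]
    simp [barlowOffset, barlowPos_apply_zero, barlowPos_apply_one, barlowPos_apply_two]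
    nlinarith [h3, hh]

/-- Two positions at squared distance `1/3` cannot both be balls of a unit packing. -/
theorem not_both_mem_of_norm_sq {X : Finset (EuclideanSpace ℝ (Fin 3))}
    (hX : ∀ p ∈ X, ∀ q ∈ X, p ≠ q → 1 ≤ dist p q) {a b : EuclideanSpace ℝ (Fin 3)}
    (h : ‖a - b‖ ^ 2 = 1 / 3) (ha : a ∈ X) (hb : b ∈ X) : False := by
  have hne : a ≠ b := by
    intro e; rw [e, sub_self, norm_zero] at h; norm_num at h
  have h1 := hX a ha b hb hne
  rw [dist_eq_norm] at h1
  nlinarith [norm_nonneg (a - b)]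

/-! ### The per-ball lemma -/

/-- **(T2) at a ball of a basal Barlow film under the height along `u + v + t`.**  `X` a unit
packing, `P ⊆ X`, `q` a ball all of whose partners are at basal Barlow contact vectors from `q`, `Φ`
ordered like `⟪·, u+v+t⟫` on the film partners, substrate partners strictly below along `u + v + t`.
Then `#below + #plug ≤ (12 − deg q) + #above`. -/
theorem axis_noGainPotential (X P : Finset (EuclideanSpace ℝ (Fin 3)))
    (hX : ∀ p ∈ X, ∀ q ∈ X, p ≠ q → 1 ≤ dist p q) (hPX : P ⊆ X)
    (q : EuclideanSpace ℝ (Fin 3)) (Φ : EuclideanSpace ℝ (Fin 3) → ℤ)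
    (hlt : ∀ x ∈ X \ P, dist q x = 1 → (Φ x < Φ q ↔
      ⟪x, barlowPos 1 (Real.sqrt (2 / 3)) constHagg 1 1 1⟫_ℝ < ⟪q, barlowPos 1 (Real.sqrt (2 / 3)) constHagg 1 1 1⟫_ℝ))
    (heq : ∀ x ∈ X \ P, dist q x = 1 → (Φ x = Φ q ↔
      ⟪x, barlowPos 1 (Real.sqrt (2 / 3)) constHagg 1 1 1⟫_ℝ = ⟪q, barlowPos 1 (Real.sqrt (2 / 3)) constHagg 1 1 1⟫_ℝ))
    (hplug : ∀ p ∈ P, dist q p = 1 →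
      ⟪p, barlowPos 1 (Real.sqrt (2 / 3)) constHagg 1 1 1⟫_ℝ < ⟪q, barlowPos 1 (Real.sqrt (2 / 3)) constHagg 1 1 1⟫_ℝ)
    (hdir : ∀ x ∈ X, dist q x = 1 →
      (∃ c ∈ ([((0 : ℤ), (1 : ℤ), (0 : ℤ)), (0, 0, 1), (1, 0, 0), (0, 1, -1), (-1, 1, 0), (-1, 0, 1)] :
          List (ℤ × ℤ × ℤ)),
          x - q = barlowPos 1 (Real.sqrt (2 / 3)) constHagg c.1 c.2.1 c.2.2 ∨
          x - q = -barlowPos 1 (Real.sqrt (2 / 3)) constHagg c.1 c.2.1 c.2.2) ∨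
        (∃ c ∈ ([((1 : ℤ), (-1 : ℤ), (-1 : ℤ)), (1, 0, -1), (1, -1, 0)] : List (ℤ × ℤ × ℤ)),
          x - q = barlowPos 1 (Real.sqrt (2 / 3)) constHagg c.1 c.2.1 c.2.2 + barlowOffset 1 ∨
          x - q = -(barlowPos 1 (Real.sqrt (2 / 3)) constHagg c.1 c.2.1 c.2.2 + barlowOffset 1))) :
    (((X \ P).filter fun x => dist q x = 1 ∧ Φ x < Φ q).card : ℤ)
        + ((P.filter fun p => dist q p = 1).card : ℤ)
      ≤ (12 - ((X.filter fun x => dist q x = 1).card : ℤ))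
        + (((X \ P).filter fun x => dist q x = 1 ∧ Φ q < Φ x).card : ℤ) := by
  classical
  rw [noGainPotential_iff X P hPX Φ q]
  -- names for the axis and the nine relevant vectors
  set m : EuclideanSpace ℝ (Fin 3) := barlowPos 1 (Real.sqrt (2 / 3)) constHagg 1 1 1 with hm
  set nu : EuclideanSpace ℝ (Fin 3) := -barlowPos 1 (Real.sqrt (2 / 3)) constHagg 0 1 0 with hnu
  set nv : EuclideanSpace ℝ (Fin 3) := -barlowPos 1 (Real.sqrt (2 / 3)) constHagg 0 0 1 with hnv
  set vA : EuclideanSpace ℝ (Fin 3) := barlowPos 1 (Real.sqrt (2 / 3)) constHagg 1 (-1) (-1) + barlowOffset 1 with hvA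
  set nt : EuclideanSpace ℝ (Fin 3) := -barlowPos 1 (Real.sqrt (2 / 3)) constHagg 1 0 0 with hnt
  set nB1 : EuclideanSpace ℝ (Fin 3) := -(barlowPos 1 (Real.sqrt (2 / 3)) constHagg 1 0 (-1) + barlowOffset 1) with hnB1
  set nB2 : EuclideanSpace ℝ (Fin 3) := -(barlowPos 1 (Real.sqrt (2 / 3)) constHagg 1 (-1) 0 + barlowOffset 1) with hnB2
  set uv : EuclideanSpace ℝ (Fin 3) := barlowPos 1 (Real.sqrt (2 / 3)) constHagg 0 1 (-1) with huv
  set tu : EuclideanSpace ℝ (Fin 3) := -barlowPos 1 (Real.sqrt (2 / 3)) constHagg (-1) 1 0 with htu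
  set tv : EuclideanSpace ℝ (Fin 3) := -barlowPos 1 (Real.sqrt (2 / 3)) constHagg (-1) 0 1 with htv
  set ut : EuclideanSpace ℝ (Fin 3) := barlowPos 1 (Real.sqrt (2 / 3)) constHagg (-1) 1 0 with hut
  set vt : EuclideanSpace ℝ (Fin 3) := barlowPos 1 (Real.sqrt (2 / 3)) constHagg (-1) 0 1 with hvt
  obtain ⟨cAU, cAV, cTB1, cTB2, cUB2, cVB1⟩ := axis_conflict_norms
  -- conflicts as statements about `X`
  have conflict : ∀ {a b : EuclideanSpace ℝ (Fin 3)}, ‖a - b‖ ^ 2 = 1 / 3 →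
      q + a ∈ X → q + b ∈ X → False := by
    intro a b h ha hb
    exact not_both_mem_of_norm_sq hX (a := q + a) (b := q + b) (by rw [add_sub_add_left_eq_sub]; exact h) ha hb
  -- the weight-two set and the level set
  set A := (P.filter fun p => dist q p = 1) ∪ ((X \ P).filter fun x => dist q x = 1 ∧ Φ x < Φ q) with hA
  set L := (X \ P).filter fun x => dist q x = 1 ∧ Φ x = Φ q with hL
  have hPQ : Disjoint P (X \ P) := disjoint_sdiff
  have hAcard : A.card = (P.filter fun p => dist q p = 1).card +
      ((X \ P).filter fun x => dist q x = 1 ∧ Φ x < Φ q).card := by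
    rw [hA, card_union_of_disjoint]; exact disjoint_filter_filter hPQ
  -- classification of the elements of `A` and `L`
  have hAclass : ∀ x ∈ A, x ∈ X ∧ ((x - q = nu ∨ x - q = nv) ∨ x - q = vA ∨
      (x - q = nt ∨ x - q = nB1 ∨ x - q = nB2)) := by
    intro x hx
    rw [hA, mem_union, mem_filter, mem_filter] at hx
    have hxX : x ∈ X := by rcases hx with ⟨h, _⟩ | ⟨h, _⟩; exacts [hPX h, (mem_sdiff.1 h).1]
    have hd : dist q x = 1 := by rcases hx with ⟨_, h⟩ | ⟨_, h, _⟩ <;> exact h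
    have hneg : ⟪x - q, m⟫_ℝ < 0 := by
      rw [inner_sub_left]
      rcases hx with ⟨hxP, _⟩ | ⟨hxQ, _, hΦ⟩
      · linarith [hplug x hxP hd]
      · linarith [(hlt x hxQ hd).1 hΦ]
    exact ⟨hxX, axis_negative_directions (hdir x hxX hd) hneg⟩
  have hLclass : ∀ x ∈ L, x ∈ X ∧ ((x - q = uv ∨ x - q = -uv) ∨ (x - q = tu ∨ x - q = tv) ∨
      (x - q = ut ∨ x - q = vt)) := by
    intro x hx
    rw [hL, mem_filter] at hx
    obtain ⟨hxQ, hd, hΦ⟩ := hx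
    have hxX : x ∈ X := (mem_sdiff.1 hxQ).1
    have hzero : ⟪x - q, m⟫_ℝ = 0 := by
      rw [inner_sub_left]; linarith [(heq x hxQ hd).1 hΦ]
    exact ⟨hxX, axis_level_directions (hdir x hxX hd) hzero⟩
  -- `x = q + (x - q)`
  have hxq : ∀ x d : EuclideanSpace ℝ (Fin 3), x - q = d → x = q + d := fun x d h => by rw [← h]; abel
  -- split `A` and `L` into the three height classes
  set Aip := A.filter fun x => x - q = nu ∨ x - q = nv with hAip
  set Aup := A.filter fun x => x - q = vA with hAup
  set Adn := A.filter fun x => x - q = nt ∨ x - q = nB1 ∨ x - q = nB2 with hAdn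
  set Lip := L.filter fun x => x - q = uv ∨ x - q = -uv with hLip
  set Lup := L.filter fun x => x - q = tu ∨ x - q = tv with hLup
  set Ldn := L.filter fun x => x - q = ut ∨ x - q = vt with hLdn
  have hAsplit : A.card ≤ Aip.card + Aup.card + Adn.card := by
    have hsub : A ⊆ Aip ∪ Aup ∪ Adn := by
      intro x hx
      rcases (hAclass x hx).2 with h | h | h
      · exact mem_union.2 (Or.inl (mem_union.2 (Or.inl (mem_filter.2 ⟨hx, h⟩))))
      · exact mem_union.2 (Or.inl (mem_union.2 (Or.inr (mem_filter.2 ⟨hx, h⟩))))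
      · exact mem_union.2 (Or.inr (mem_filter.2 ⟨hx, h⟩))
    exact (card_le_card hsub).trans ((card_union_le _ _).trans (by
      have := card_union_le Aip Aup; omega))
  have hLsplit : L.card ≤ Lip.card + Lup.card + Ldn.card := by
    have hsub : L ⊆ Lip ∪ Lup ∪ Ldn := by
      intro x hx
      rcases (hLclass x hx).2 with h | h | h
      · exact mem_union.2 (Or.inl (mem_union.2 (Or.inl (mem_filter.2 ⟨hx, h⟩))))
      · exact mem_union.2 (Or.inl (mem_union.2 (Or.inr (mem_filter.2 ⟨hx, h⟩))))
      · exact mem_union.2 (Or.inr (mem_filter.2 ⟨hx, h⟩))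
    exact (card_le_card hsub).trans ((card_union_le _ _).trans (by
      have := card_union_le Lip Lup; omega))
  -- a filter whose elements are `q + d₁` or `q + d₂` has at most two elements, etc.
  have two : ∀ (S : Finset (EuclideanSpace ℝ (Fin 3))) (d₁ d₂ : EuclideanSpace ℝ (Fin 3)),
      (∀ x ∈ S, x - q = d₁ ∨ x - q = d₂) → S.card ≤ 2 := by
    intro S d₁ d₂ h
    have hsub : S ⊆ {q + d₁, q + d₂} := by
      intro x hx
      rcases h x hx with e | e
      · rw [hxq x d₁ e]; simp
      · rw [hxq x d₂ e]; simp
    exact (card_le_card hsub).trans (card_insert_le _ _ |>.trans (by simp))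
  have one : ∀ (S : Finset (EuclideanSpace ℝ (Fin 3))) (d₁ : EuclideanSpace ℝ (Fin 3)),
      (∀ x ∈ S, x - q = d₁) → S.card ≤ 1 := by
    intro S d₁ h
    have hsub : S ⊆ {q + d₁} := by
      intro x hx; rw [hxq x d₁ (h x hx)]; simp
    exact (card_le_card hsub).trans (by simp)
  have zero : ∀ (S : Finset (EuclideanSpace ℝ (Fin 3))), (∀ x ∈ S, False) → S.card = 0 := by
    intro S h; rw [Finset.card_eq_zero]; exact Finset.eq_empty_of_forall_notMem h
  -- membership unpacking
  have memA : ∀ x ∈ A, x ∈ X := fun x hx => (hAclass x hx).1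
  have memL : ∀ x ∈ L, x ∈ X := fun x hx => (hLclass x hx).1
  have occ : ∀ x d : EuclideanSpace ℝ (Fin 3), x ∈ X → x - q = d → q + d ∈ X :=
    fun x d hx h => by rw [← hxq x d h]; exact hx
  -- in-plane: `2·2 + 2`
  have hip : Aip.card ≤ 2 := two Aip nu nv fun x hx => (mem_filter.1 hx).2
  have hlip : Lip.card ≤ 2 := two Lip uv (-uv) fun x hx => (mem_filter.1 hx).2
  -- up: `2·#Aup + #Lup ≤ 2`
  have hup : 2 * Aup.card + Lup.card ≤ 2 := by
    by_cases hAocc : q + vA ∈ X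
    · have h1 : Aup.card ≤ 1 := one Aup vA fun x hx => (mem_filter.1 hx).2
      have h2 : Lup.card = 0 := zero Lup fun x hx => by
        obtain ⟨hxL, h⟩ := mem_filter.1 hx
        rcases h with h | h
        · exact conflict cAU hAocc (occ x tu (memL x hxL) h)
        · exact conflict cAV hAocc (occ x tv (memL x hxL) h)
      omega
    · have h1 : Aup.card = 0 := zero Aup fun x hx => by
        obtain ⟨hxA, h⟩ := mem_filter.1 hx
        exact hAocc (occ x vA (memA x hxA) h)
      have h2 : Lup.card ≤ 2 := two Lup tu tv fun x hx => (mem_filter.1 hx).2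
      omega
  -- down: `2·#Adn + #Ldn ≤ 4`
  have hdn : 2 * Adn.card + Ldn.card ≤ 4 := by
    have hLdn2 : Ldn.card ≤ 2 := two Ldn ut vt fun x hx => (mem_filter.1 hx).2
    by_cases hT : q + nt ∈ X
    · -- `−B₁`, `−B₂` are empty; `Adn ⊆ {q − t}`
      have h1 : Adn.card ≤ 1 := one Adn nt fun x hx => by
        obtain ⟨hxA, h⟩ := mem_filter.1 hx
        rcases h with h | h | h
        · exact h
        · exact (conflict cTB1 hT (occ x nB1 (memA x hxA) h)).elim
        · exact (conflict cTB2 hT (occ x nB2 (memA x hxA) h)).elim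
      omega
    · by_cases hB1 : q + nB1 ∈ X <;> by_cases hB2 : q + nB2 ∈ X
      · have h1 : Adn.card ≤ 2 := two Adn nB1 nB2 fun x hx => by
          obtain ⟨hxA, h⟩ := mem_filter.1 hx
          rcases h with h | h | h
          · exact (hT (occ x nt (memA x hxA) h)).elim
          · exact Or.inl h
          · exact Or.inr h
        have h2 : Ldn.card = 0 := zero Ldn fun x hx => by
          obtain ⟨hxL, h⟩ := mem_filter.1 hx
          rcases h with h | h
          · exact conflict cUB2 (occ x ut (memL x hxL) h) hB2
          · exact conflict cVB1 (occ x vt (memL x hxL) h) hB1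
        omega
      · have h1 : Adn.card ≤ 1 := one Adn nB1 fun x hx => by
          obtain ⟨hxA, h⟩ := mem_filter.1 hx
          rcases h with h | h | h
          · exact (hT (occ x nt (memA x hxA) h)).elim
          · exact h
          · exact (hB2 (occ x nB2 (memA x hxA) h)).elim
        have h2 : Ldn.card ≤ 1 := one Ldn ut fun x hx => by
          obtain ⟨hxL, h⟩ := mem_filter.1 hx
          rcases h with h | h
          · exact h
          · exact (conflict cVB1 (occ x vt (memL x hxL) h) hB1).elim
        omega
      · have h1 : Adn.card ≤ 1 := one Adn nB2 fun x hx => by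
          obtain ⟨hxA, h⟩ := mem_filter.1 hx
          rcases h with h | h | h
          · exact (hT (occ x nt (memA x hxA) h)).elim
          · exact (hB1 (occ x nB1 (memA x hxA) h)).elim
          · exact h
        have h2 : Ldn.card ≤ 1 := one Ldn vt fun x hx => by
          obtain ⟨hxL, h⟩ := mem_filter.1 hx
          rcases h with h | h
          · exact (conflict cUB2 (occ x ut (memL x hxL) h) hB2).elim
          · exact h
        omega
      · have h1 : Adn.card = 0 := zero Adn fun x hx => by
          obtain ⟨hxA, h⟩ := mem_filter.1 hx
          rcases h with h | h | h
          · exact hT (occ x nt (memA x hxA) h)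
          · exact hB1 (occ x nB1 (memA x hxA) h)
          · exact hB2 (occ x nB2 (memA x hxA) h)
        omega
  zify at hAcard hAsplit hLsplit hip hlip hup hdn
  linarith

/-! ### The rung -/

/-- **The atom for basal Barlow films at the non-basal `(111)` axis `(u+v+t)/√6`** (`R = 1`,
`C = 0`; registered by name on stmt-Ventures-19144).  For the unit normal `ν` with
`√6 ν = barlowPos 1 1 1`, every `ρ ≥ 1`, and every finite unit packing `X ⊇ P` around the `ν`-slab
sample whose film balls are basal Barlow positions lying above the cut:
`#cross(P, X \ P) ≤ contactDeficiency (X \ P)`. -/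
theorem axisBarlowFilm_adhesion :
    ∃ R C : ℝ, 1 ≤ R ∧ ∀ ν : EuclideanSpace ℝ (Fin 3), ‖ν‖ = 1 → ∀ ρ : ℝ, R ≤ ρ →
      ∀ X P : Finset (EuclideanSpace ℝ (Fin 3)),
      (∀ p ∈ X, ∀ q ∈ X, p ≠ q → 1 ≤ dist p q) → P ⊆ X →
      (∀ p, p ∈ P ↔ (p ∈ fccStacking 1 (Real.sqrt (2 / 3)) ∧ -(2 * R) ≤ ⟪p, ν⟫_ℝ ∧
        ⟪p, ν⟫_ℝ ≤ -R ∧ ‖p‖ ^ 2 - ⟪p, ν⟫_ℝ ^ 2 ≤ ρ ^ 2)) →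
      Real.sqrt 6 • ν = barlowPos 1 (Real.sqrt (2 / 3)) constHagg 1 1 1 →
      (∀ q ∈ X \ P, q ∈ fccStacking 1 (Real.sqrt (2 / 3)) ∨
        q - barlowOffset 1 ∈ fccStacking 1 (Real.sqrt (2 / 3)) ∨
        q + barlowOffset 1 ∈ fccStacking 1 (Real.sqrt (2 / 3))) →
      (∀ q ∈ X \ P, -R < ⟪q, ν⟫_ℝ) →
      ((((P ×ˢ (X \ P)).filter fun pq => dist pq.1 pq.2 = 1).card : ℕ) : ℝ) ≤
        contactDeficiency (X \ P) + C * ρ := by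
  classical
  refine ⟨1, 0, le_rfl, fun ν hν ρ hρ X P hX hPX hP hax hfilm habove => ?_⟩
  rw [zero_mul, add_zero]
  have h6 : 0 < Real.sqrt 6 := Real.sqrt_pos.2 (by norm_num)
  -- `⟪x, u+v+t⟫ = √6 ⟪x, ν⟫`: same order as the `ν`-height
  have hinner : ∀ x : EuclideanSpace ℝ (Fin 3),
      ⟪x, barlowPos 1 (Real.sqrt (2 / 3)) constHagg 1 1 1⟫_ℝ = Real.sqrt 6 * ⟪x, ν⟫_ℝ := fun x => by
    rw [← hax, inner_smul_right]
  set f : EuclideanSpace ℝ (Fin 3) → ℝ := fun y =>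
    ⟪y, barlowPos 1 (Real.sqrt (2 / 3)) constHagg 1 1 1⟫_ℝ with hf
  set Φ : EuclideanSpace ℝ (Fin 3) → ℤ := fun x => (((X \ P).filter fun y => f y < f x).card : ℤ) with hΦ
  have hB : ∀ y ∈ X, y ∈ fccStacking 1 (Real.sqrt (2 / 3)) ∨
      y - barlowOffset 1 ∈ fccStacking 1 (Real.sqrt (2 / 3)) ∨
      y + barlowOffset 1 ∈ fccStacking 1 (Real.sqrt (2 / 3)) := by
    intro y hy
    by_cases hyP : y ∈ P
    · exact Or.inl ((hP y).1 hyP).1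
    · exact hfilm y (mem_sdiff.2 ⟨hy, hyP⟩)
  have hmain := cross_le_of_potential X P ∅ hX hPX (empty_subset _) Φ fun q hq => by
    rw [sdiff_empty] at hq
    refine axis_noGainPotential X P hX hPX q Φ (fun x hx _ => ?_) (fun x hx _ => ?_)
      (fun p hp _ => ?_) (fun x hx hd => basal_unit_vectors (hB q (mem_sdiff.1 hq).1) (hB x hx) hd)
    · simp only [hΦ]; exact rank_lt_iff (X \ P) f x q hx
    · simp only [hΦ]; exact rank_eq_iff (X \ P) f x q hx hq
    · obtain ⟨_, _, hp2, _⟩ := (hP p).1 hp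
      have := habove q hq
      rw [hinner, hinner]
      exact mul_lt_mul_of_pos_left (by linarith) h6
  simpa using hmain

end Summit.Ventures.Crystal3D.Theorems

end
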